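import Literature.Computability.Complexity.CircuitEval
import Literature.Computability.Complexity.CircuitSizeProofs
import Literature.Computability.Complexity.CircuitLowerBounds
import HarnessLib

/-!
# Murray–Williams 2018, Thm. 3.1: circuit descriptions deciding a slice, and downward
# self-reducibility in circuit form

Part of the decomposition of Murray–Williams 2018, Thm. 3.1 (C. D. Murray, R. R. Williams,
*Circuit lower bounds for nondeterministic quasi-polytime: an easy witness lemma for NP and NQP*,
STOC 2018 / ECCC TR17-188, §3) over an ABSTRACT complete language `Lstar`
(`MurrayWilliams2018AlmostAE.lean`: the hardness analysis; `MurrayWilliams2018HardLanguage.lean`: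
the advice `αₙ` and the language `L₁`). Two of the structural properties of Santhanam's
`L_PSPACE` (Thm. 2.2) enter that analysis and the protocol `M₁` through circuit DESCRIPTIONS:
Merlin's message is (the description of) a circuit claimed to decide `Lstar` on one input
length, read by the tree's polynomial-time evaluator `CircEval.evalFn` (`CircuitEval.lean`,
Arora–Barak Thm. 6.18); and the downward self-reduction is used only in the proof of the
Amplification Claim, in the form "we can construct an `L_PSPACE`-oracle circuit for
`L^{ℓ+1}_PSPACE` using the `O(n^{d₁})`-time downward self-reduction. This oracle circuit has size
at most `(ℓ+1)^{2d₁}`; if we replace each `L_PSPACE` oracle query with the size-`s(m)` circuit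
`D_ℓ`, this yields a circuit `D_{ℓ+1}` of size at most `(ℓ+1)^{2d₁} · s(m)`" — the hypothesis
`hdsr : Lstar.circuitSize ℓ ≤ S → Lstar.circuitSize (ℓ+1) ≤ D ℓ S` of
`AlmostAE.eventually_lt_circuitSize_or`.

This file supplies:

* `DescribesSlice Lstar ℓ d` — the string `d`, read by the evaluator, decides `Lstar` on
  `{0,1}^ℓ` ("`C` is a circuit for `L^ℓ`"); `exists_describesSlice` — an optimal `B₂`-circuit
  for the slice has such a description of length `≤ (c+1)(8(ℓ+c)+10)`, `c = Lstar.circuitSize ℓ`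
  (`CircEval.length_desc_le`, `CircEval.evalFn_boolPair_desc`);
* `DSR Lstar` — **downward self-reducibility over the tree**: a language `lang ∈ P` on pairs
  `⟨z, d⟩` which decides `z ∈ Lstar` correctly whenever `d` describes the slice of `Lstar` at
  length `|z| - 1` (the printed polynomial-time oracle procedure with its oracle calls answered
  by the circuit `d`; Murray–Williams, proof of Thm. 2.2: "`A`: On input `y` … run the downward
  self-reduction `A₀` … For every query `x'` … query `0x'` instead");
* **`DSR.exists_circuitSize_succ_le`** — its circuit form: there is a polynomial `q` with
  `Lstar.circuitSize (ℓ+1) ≤ q(ℓ + S)` whenever `Lstar.circuitSize ℓ ≤ S` (`P ⊆ P/poly` on the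
  pair language, `exists_cktSize_boolPair_of_mem_PPoly`, with the description hard-wired,
  `CktSize.hardwire`: two extra gates) — so `hdsr` holds with `D ℓ S = q(ℓ + S)`, and
  Murray–Williams' constraint (iii) `s₁(n) ≥ s(n)^{2d₁+1}` becomes `q(m + s(m) + 2) ≤ s₁(m)`.

Definitions with bodies and theorems only; no named fact is introduced.

## References

* C. D. Murray, R. R. Williams, *Circuit lower bounds for nondeterministic quasi-polytime: an easy
  witness lemma for NP and NQP*, STOC 2018 (ECCC TR17-188), Thm. 2.2 (downward self-reducibility,
  proof) and Lemma 3.1 (Amplification Claim, proof) [MurrayWilliams2018].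
* S. Arora, B. Barak, *Computational Complexity: A Modern Approach*, CUP 2009, Thm. 6.6
  (`P ⊆ P/poly`), Thm. 6.18 (circuit evaluation), proof of Thm. 7.14 (hard-wiring)
  [AroraBarakCC2009].
-/

noncomputable section

namespace Literature.Computability.Complexity

open CircEval Polynomial

namespace AlmostAE

variable {Lstar : Language Bool}

/-! ### Descriptions deciding a slice -/

/-- **`d` describes the slice of `Lstar` at length `ℓ`**: read by the evaluator
(`CircEval.evalFn ⟨q, d⟩`), the string `d` answers membership in `Lstar` correctly on every
`q ∈ {0,1}^ℓ` (Murray–Williams: "`L^ℓ_PSPACE` has a circuit `C`"; here `C` is given by its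
description, every string being a description). [cite: MurrayWilliams2018, Thm. 3.1 (proof)] -/
def DescribesSlice (Lstar : Language Bool) (ℓ : ℕ) (d : List Bool) : Prop :=
  ∀ q : List Bool, q.length = ℓ → (evalFn (boolPair q d) = [true] ↔ q ∈ Lstar)

/-- The description of a circuit computing the slice describes the slice (transport along
`|q| = ℓ` of `CircEval.evalFn_boolPair_desc`). [cite: AroraBarakCC2009, Thm. 6.18] -/
theorem describesSlice_desc {ℓ : ℕ} (C : Circuit (Fin ℓ)) (hCB : C.IsOver B2)
    (hCf : C.Computes (Lstar.sliceFn ℓ)) : DescribesSlice Lstar ℓ (desc C) := by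
  intro q hq
  subst hq
  rw [evalFn_boolPair_desc q C fun g hg => hCB g hg, hCf q.get]
  change [Lstar.boolIndicator (List.ofFn q.get)] = [true] ↔ q ∈ Lstar
  rw [List.ofFn_get, List.cons.injEq]
  simp only [and_true]
  exact (Set.mem_iff_boolIndicator _ _).symm

/-- **Every slice has a short correct description**: an optimal `B₂`-circuit for `Lstar` at
length `ℓ`, of size `c = Lstar.circuitSize ℓ`, has a description of length
`≤ (c+1)(8(ℓ+c)+10)` deciding the slice. [cite: AroraBarakCC2009, Thm. 6.18] -/
theorem exists_describesSlice (Lstar : Language Bool) (ℓ : ℕ) :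
    ∃ d : List Bool, DescribesSlice Lstar ℓ d ∧
      d.length ≤ (Lstar.circuitSize ℓ + 1) * (8 * (ℓ + Lstar.circuitSize ℓ) + 10) := by
  obtain ⟨C, hCB, hCf, hCs⟩ := exists_circuit_size_eq_circuitSize Lstar ℓ
  exact ⟨desc C, describesSlice_desc C hCB hCf, hCs ▸ length_desc_le C⟩

/-! ### Downward self-reducibility -/

/-- **Downward self-reducibility of `Lstar`, over the tree** (Murray–Williams 2018, Thm. 2.2:
`L_PSPACE` is downward self-reducible — a polynomial-time procedure decides `L^{ℓ+1}` with
oracle access to `L^ℓ`; here the oracle calls are answered by a description `d` of the slice at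
length `ℓ`, part of the input): a language `lang ∈ P` on pairs `⟨z, d⟩` such that, whenever `d`
describes the slice of `Lstar` at length `ℓ`, `⟨z, d⟩ ∈ lang ⟺ z ∈ Lstar` for all `z` of length
`ℓ + 1`. [cite: MurrayWilliams2018, Thm. 2.2 (downward self-reducibility)] -/
structure DSR (Lstar : Language Bool) where
  /-- the self-reduction, as a language on pairs `⟨z, d⟩` -/
  lang : Language Bool
  /-- it is polynomial-time decidable -/
  mem_P : lang ∈ Classes.P
  /-- and correct whenever `d` describes the previous slice -/
  correct : ∀ (ℓ : ℕ) (d : List Bool), DescribesSlice Lstar ℓ d →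
    ∀ z : List Bool, z.length = ℓ + 1 → (boolPair z d ∈ lang ↔ z ∈ Lstar)

/-- The overhead polynomial of the circuit form: `q = A + q₀ ∘ A + 2` with
`A = 2X + 4 + (X+1)(8X+10)` bounding `2(ℓ+1) + 2 + |d|` in terms of `X = ℓ + S`. [folklore] -/
def overhead (q₀ : Polynomial ℕ) : Polynomial ℕ :=
  (2 * X + 4 + (X + 1) * (8 * X + 10)) + q₀.comp (2 * X + 4 + (X + 1) * (8 * X + 10)) + 2

/-- Evaluation of `overhead`. [folklore] -/
theorem eval_overhead (q₀ : Polynomial ℕ) (t : ℕ) :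
    (overhead q₀).eval t =
      (2 * t + 4 + (t + 1) * (8 * t + 10)) + q₀.eval (2 * t + 4 + (t + 1) * (8 * t + 10)) + 2 := by
  simp [overhead, eval_comp]

/-- **Downward self-reducibility in circuit form** (the Amplification Claim's "replace each
oracle query with the size-`s(m)` circuit `D_ℓ`"): for a downward self-reducible `Lstar` there is
a polynomial `q` such that `Lstar.circuitSize (ℓ + 1) ≤ q(ℓ + S)` whenever
`Lstar.circuitSize ℓ ≤ S` — the `P`-language `lang` has polynomial-size circuits on pairs
(`P ⊆ P/poly`, `exists_cktSize_boolPair_of_mem_PPoly`), and hard-wiring a shortest correct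
description of the slice at length `ℓ` (`exists_describesSlice`, `CktSize.hardwire`) leaves a
circuit on `ℓ + 1` inputs computing the next slice. This is the hypothesis `hdsr` of
`AlmostAE.eventually_lt_circuitSize_or` with `D ℓ S = q(ℓ + S)`.
[cite: MurrayWilliams2018, Lemma 3.1 (proof of the Amplification Claim)] -/
theorem DSR.exists_circuitSize_succ_le (R : DSR Lstar) :
    ∃ q : Polynomial ℕ, ∀ ℓ S : ℕ, Lstar.circuitSize ℓ ≤ S →
      Lstar.circuitSize (ℓ + 1) ≤ q.eval (ℓ + S) := by
  obtain ⟨q₀, hq₀⟩ := exists_cktSize_boolPair_of_mem_PPoly (P_subset_PPoly_holds R.mem_P)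
  refine ⟨overhead q₀, fun ℓ S hS => ?_⟩
  obtain ⟨d, hd, hdlen⟩ := exists_describesSlice Lstar ℓ
  -- the pair circuit at lengths `(ℓ + 1, |d|)`, with `d` hard-wired
  have h1 := (hq₀ (ℓ + 1) d.length).hardwire d.get
  obtain ⟨C, hCB, hCs, hCe⟩ := h1.toCircuit
  have hcomp : C.Computes (Lstar.sliceFn (ℓ + 1)) := by
    intro x
    rw [hCe x]
    simp only [Sum.elim_inl, Sum.elim_inr, List.ofFn_get]
    have hlen : (List.ofFn x).length = ℓ + 1 := List.length_ofFn
    have hiff := R.correct ℓ d hd (List.ofFn x) hlen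
    change Set.boolIndicator R.lang (boolPair (List.ofFn x) d) = Lstar.boolIndicator (List.ofFn x)
    by_cases hx : List.ofFn x ∈ Lstar
    · rw [(Set.mem_iff_boolIndicator _ _).1 hx, (Set.mem_iff_boolIndicator _ _).1 (hiff.2 hx)]
    · rw [(Set.notMem_iff_boolIndicator _ _).1 hx,
        (Set.notMem_iff_boolIndicator _ _).1 fun h => hx (hiff.1 h)]
  -- the size bound, in terms of `t = ℓ + S`
  have hB : d.length ≤ (S + 1) * (8 * (ℓ + S) + 10) :=
    hdlen.trans (Nat.mul_le_mul (by omega) (by omega))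
  have hA : 2 * (ℓ + 1) + 2 + d.length ≤ 2 * (ℓ + S) + 4 + (ℓ + S + 1) * (8 * (ℓ + S) + 10) := by
    have : (S + 1) * (8 * (ℓ + S) + 10) ≤ (ℓ + S + 1) * (8 * (ℓ + S) + 10) :=
      Nat.mul_le_mul_right _ (by omega)
    omega
  calc Lstar.circuitSize (ℓ + 1) ≤ C.size := circuitSizeOver_le_of_computes C hCB hcomp
    _ ≤ 2 * (ℓ + 1) + 2 + d.length + q₀.eval (2 * (ℓ + 1) + 2 + d.length) + 2 := hCs
    _ ≤ (2 * (ℓ + S) + 4 + (ℓ + S + 1) * (8 * (ℓ + S) + 10)) +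
          q₀.eval (2 * (ℓ + S) + 4 + (ℓ + S + 1) * (8 * (ℓ + S) + 10)) + 2 :=
        Nat.add_le_add_right (Nat.add_le_add hA (natPoly_eval_mono q₀ hA)) 2
    _ = (overhead q₀).eval (ℓ + S) := (eval_overhead q₀ (ℓ + S)).symm

end AlmostAE

end Literature.Computability.Complexity

end
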